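import Literature.AlgebraicGeometry.ShimuraVarieties.UnitaryBallSpecialCurveFrame
import Literature.AlgebraicGeometry.ShimuraVarieties.UnitaryBallSpecialCurveDatumOfCode
import Literature.AlgebraicGeometry.ShimuraVarieties.UnitaryShimuraCurveSourceClauses
import Literature.NumberTheory.Automorphic.UnitaryGroupFieldRangeTransport
import HarnessLib

/-!
# The translated sub-discs `unif((γB)^τ(𝔻))` of an `L`-coded compact ball quotient are Zariski-CLOSED on complex points
# (Kudla–Millson special cycles, read over a SubfieldCode — road (ii) leaf L3.2 «F-IMG», per-piece half)

Topic `AlgebraicGeometry/ShimuraVarieties`, namespace `Literature.AlgebraicGeometry.ShimuraVarieties.UnitaryBallUniformisationDatum`.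
THEOREMS ONLY (no definition, no named fact, no instance, no `sorry`).  Cell `hodgecm-mathlib`, road (ii) «embedded-curve
descent» (census «GS-3 ⇐ #62», CUT `CUT-R2-5-FIELDS` leaf L3.2); books 0.

DATA.  A compact ball quotient `D : UnitaryBallUniformisationDatum 2 X` (`X(ℂ) ≅ Γ∖𝔹²`) whose CM subfield `D.E ⊆ ℂ` is CODED from an
abstract CM field `L` with embedding `τ` — the SubfieldCode currency of ★ `UnitaryBallH1RestrictionSubfieldCode` / A-plan1's
«E-OPACITY» ruling (2026-08-29T05:49:44Z): `e : L ≃+* D.E` over `τ` (`((e x) : ℂ) = τ x`) with `D.H = H^e` — and an `L`-frame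
`ᵗ(cB)·(a·H)·B = J⋆ ⊕ J⊥` of the rank-3 hermitian space with `τ a` a positive real and `Re τ(J⊥₀₀) > 0` (the sub-plane
`B(· ⊕ 0)` carries the signature-`(1,1)` form `a⁻¹J⋆`; its orthogonal line `B e₃` is then TOTALLY positive definite: at the place of
`τ` by hypothesis, elsewhere because the datum's form is positive definite there — ★ `forall_re_pos_subformRight`).

RESULT **`exists_isClosed_pt_mem_iff_eq_unif_frameEmbNeg`**: for every rational isometry `γ ∈ U(H)(L⁺)` there is a
Zariski-CLOSED `Z ⊆ X` whose complex points are EXACTLY the image `{unif((γB)^τ(x ⊕ 0)) : x ∈ 𝔻(J⋆^τ)}` of the translated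
sub-disc (★ `frameEmbNeg τ (γB)`).  Proof: over the code, `B′ := GL(e)(γB)` is a `D.E`-frame with
`ᵗσ(B′)·D.H·B′ = (a⁻¹J⋆)^e ⊕ (a⁻¹J⊥)^e` (★ `formCongr_mul_of_mem_rational` + ★ `formCongr_glMap_code_eq_finSum` of
`UnitaryBallSpecialCurveDatumOfCode`); its last column spans a totally positive definite `D.E`-line `W` (★ γ1
`isTotallyPositive_span_lastCol`, positivity ★ `forall_re_pos_subformRight` / `re_pos_code_subformRight`); by the THEOREM ★ `PicardCM.specialCyclesAlgebraic_holds` ([KudlaMillson1990] Lemma 1.1 + Chow)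
the special cycle `unif(𝔹(W^⊥))` is the complex-point set of a closed `Z`; and `𝔹(W^⊥) = (γB)^τ(𝔻)` exactly: the orthogonal
complement of the last column is the image of the embedding matrix (★ γ1 `exists_embMatrix_mulVec_eq_of_pairE_eq_zero`,
`hermForm_map_span_lastCol_embMatrix_mulVec`), which carries `𝔻((a⁻¹J⋆)^τ) = 𝔻(J⋆^τ)` onto the negative vectors
(★ `embMatrix_mulVec_mem_cone_iff`), and `embMatrix(B′)·x = (γB)^τ(x ⊕ 0)` (★ `embMatrix_mulVec_eq_map_mulVec_append` + the code).
This is the per-piece clause `hZ` of ★ `RecordSystem.mem_range_emb_of_pt_mem_closure_of_pieces` (L3.2 part (a)).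

## References
* [KudlaMillson1990] S. Kudla, J. Millson, Publ. Math. IHÉS 71 (1990), Lemma 1.1, p. 128 and p. 133.
* [BergeronMillsonMoeglin2016Balls] N. Bergeron, J. Millson, C. Moeglin, Acta Math. 216 (2016), Introduction §1.7, Part 2 §§1.1–1.3, 3.1–3.3.
* [Kudla1984] S. Kudla, *Seesaw dual reductive pairs* (1984), §1 (frames of orthogonal sums).
-/

set_option autoImplicit false

noncomputable section

open scoped ComplexOrder Matrix
open Matrix Complex NumberField Set Function
open Literature.NumberTheory.Automorphic Literature.NumberTheory.Automorphic.UnitaryGroup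
open Literature.NumberTheory.Automorphic.CodeField

namespace Literature.AlgebraicGeometry.ShimuraVarieties

open Literature.AlgebraicGeometry.Motives (SchemeOver ComplexPoints)
open UnitaryCanonicalModel (frameEmbNeg frameEmbNeg_mem_negCone)

namespace UnitaryBallUniformisationDatum

variable {L : Type} [Field L] [NumberField L] [IsCMField L] (τ : L →+* ℂ) {H : Matrix (Fin 3) (Fin 3) L}
  {X : SchemeOver ℂ} (D : UnitaryBallUniformisationDatum 2 X)
  (e : L ≃+* ↥D.E) (he : ∀ x : L, ((e x : ↥D.E) : ℂ) = τ x) (hH : D.H = H.map e.toRingHom)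
  {Jstar : Matrix (Fin 2) (Fin 2) L} (Jperp : Matrix (Fin 1) (Fin 1) L) (B : GL (Fin 3) L) {a : L} (ha : a ≠ 0)
  (hB : formCongr ((IsCMField.complexConj L : L ≃ₐ[↥(maximalRealSubfield L)] L) : L →+* L) B (a • H) = finSum 2 1 Jstar Jperp)
  (hτa : 0 < (τ a).re) (hτa' : (τ a).im = 0)

/-! ### §1 Read-outs of the code -/

include he in
omit [NumberField L] [IsCMField L] in
/-- `subtype ∘ e = τ` on matrices: `(M^e)^{subtype} = M^τ`. [cite: BergeronMillsonMoeglin2016Balls, Part 2 §1.1] -/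
theorem map_ringEquiv_map_subtype_eq {m n : Type*} (M : Matrix m n L) :
    (M.map e.toRingHom).map D.E.subtype = M.map τ := by
  ext i j
  simp only [Matrix.map_apply, RingEquiv.toRingHom_eq_coe, RingHom.coe_coe, Subfield.coe_subtype, he]

include he hH in
omit [NumberField L] [IsCMField L] in
/-- The complex form of the coded datum: `D.Hℂ = H^τ`. [cite: BergeronMillsonMoeglin2016Balls, Part 2 §1.1] -/
theorem Hℂ_eq_map_of_code : D.Hℂ = H.map τ := by
  change D.H.map D.E.subtype = H.map τ
  rw [hH, map_ringEquiv_map_subtype_eq τ D e he]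

include he in
omit [NumberField L] [IsCMField L] in
/-- **The coded frame's embedding matrix IS the frame embedding `(B₀)^τ(· ⊕ 0)`**: for `B′ = GL(e) B₀`,
`embMatrix(B′)·v = frameEmbNeg τ B₀ v` (★ γ1 `embMatrix_mulVec_eq_map_mulVec_append` + `subtype ∘ e = τ`). [cite: Kudla1984, §1] -/
theorem embMatrix_glMap_mulVec_eq_frameEmbNeg (B₀ : GL (Fin 3) L) (v : Fin 2 → ℂ) :
    ((((Matrix.GeneralLinearGroup.map e.toRingHom B₀ : GL (Fin 3) ↥D.E) : Matrix (Fin 3) (Fin 3) ↥D.E).submatrix id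
        Fin.castSucc).map D.E.subtype) *ᵥ v = frameEmbNeg τ B₀ v := by
  rw [D.embMatrix_mulVec_eq_map_mulVec_append]
  change (((B₀ : Matrix (Fin 3) (Fin 3) L).map e.toRingHom).map D.E.subtype) *ᵥ _ = _
  rw [map_ringEquiv_map_subtype_eq τ D e he]
  rfl

omit [NumberField L] [IsCMField L] in
/-- Scaling a complex Gram matrix by a positive real does not change its negative cone. [cite: BergeronMillsonMoeglin2016Balls, Part 2 §1.3] -/
theorem negCone_smul_eq_of_pos {m : Type*} [Fintype m] (M : Matrix m m ℂ) {r : ℂ} (hr : 0 < r.re) (hr' : r.im = 0) :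
    negCone (r • M) = negCone M := by
  ext v
  rw [mem_negCone_iff, mem_negCone_iff, Matrix.smul_mulVec, dotProduct_smul, smul_eq_mul, Complex.mul_re, hr', zero_mul,
    sub_zero]
  constructor
  · intro h
    rcases mul_neg_iff.1 h with ⟨-, hx⟩ | ⟨hneg, -⟩
    · exact hx
    · exact absurd hneg (not_lt.2 hr.le)
  · intro h
    exact mul_neg_of_pos_of_neg hr h

include he hτa hτa' in
omit [NumberField L] [IsCMField L] in
/-- The sub-form read through the code and the scalar: `𝔻(((a⁻¹J⋆)^e)^{subtype}) = 𝔻(J⋆^τ)` (`τ a` a positive real;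
★ `map_code_smul_map_subtype`). [cite: BergeronMillsonMoeglin2016Balls, Part 2 §1.3] -/
theorem negCone_map_code_smul_eq :
    negCone (((a⁻¹ • Jstar).map e).map D.E.subtype) = negCone (Jstar.map τ) := by
  rw [D.map_code_smul_map_subtype τ e he (a := a) Jstar]
  have hτa0 : τ a ≠ 0 := fun h => by rw [h, Complex.zero_re] at hτa; exact lt_irrefl _ hτa
  refine negCone_smul_eq_of_pos _ ?_ ?_
  · rw [Complex.inv_re]
    exact div_pos hτa (Complex.normSq_pos.2 hτa0)
  · rw [Complex.inv_im, hτa', neg_zero, zero_div]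

/-! ### §2 The coded frame of `γB` and its totally positive last column -/

include he hH hB ha in
/-- **The coded frame equation for a translated frame**: for `γ ∈ U(H)(L⁺)`, `B′ := GL(e)(γB)` satisfies
`ᵗσ(B′)·D.H·B′ = (a⁻¹J⋆)^e ⊕ᶠ (a⁻¹J⊥)^e` (`γ` is an isometry — ★ `formCongr_mul_of_mem_rational` — then ★
`formCongr_glMap_code_eq_finSum` transports the `L`-frame along the code). [cite: Kudla1984, §1] [cite: BergeronMillsonMoeglin2016Balls, Part 2 §3.1] -/
theorem formCongr_glMap_code_mul_eq_finSum (γ : ↥(rational (↥(maximalRealSubfield L)) L (IsCMField.complexConj L) 3 H)) :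
    formCongr (conjRingHom D.E) (Matrix.GeneralLinearGroup.map e.toRingHom ((γ : GL (Fin 3) L) * B)) D.H =
      finSum 2 1 ((a⁻¹ • Jstar).map e) ((a⁻¹ • Jperp).map e) := by
  have hγB : formCongr (IsCMField.complexConj L).toRingEquiv.toRingHom ((γ : GL (Fin 3) L) * B) (a • H) = finSum 2 1 Jstar Jperp := by
    rw [← hB]
    exact formCongr_mul_of_mem_rational (H := H) γ B a
  exact D.formCongr_glMap_code_eq_finSum τ e he hH _ ha Jstar Jperp hγB

/-! ### §3 The translated sub-disc is Zariski-closed on complex points -/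

include he hH hB ha hτa hτa' in
/-- **The translated sub-disc `unif((γB)^τ(𝔻))` of an `L`-coded compact ball quotient is the complex-point set of a Zariski-closed
subset** — Kudla–Millson's algebraicity of special cycles (the THEOREM ★ `PicardCM.specialCyclesAlgebraic_holds`) for the totally
positive `D.E`-line spanned by the last column of the coded frame `GL(e)(γB)`, whose orthogonal sub-ball is exactly `(γB)^τ(𝔻(J⋆^τ))`.
This is the per-piece clause `hZ` of ★ `RecordSystem.mem_range_emb_of_pt_mem_closure_of_pieces` (road (ii) leaf L3.2).
[cite: KudlaMillson1990, Lemma 1.1, p. 128 and p. 133] [cite: BergeronMillsonMoeglin2016Balls, Introduction §1.7 and Part 2 §§3.1–3.3] -/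
theorem exists_isClosed_pt_mem_iff_eq_unif_frameEmbNeg (hpos : 0 < (τ (Jperp 0 0)).re)
    (γ : ↥(rational (↥(maximalRealSubfield L)) L (IsCMField.complexConj L) 3 H)) :
    ∃ Z : Set ↥X.left, IsClosed Z ∧ ∀ P : ComplexPoints X,
      P.pt ∈ Z ↔ ∃ x ∈ negCone (Jstar.map τ), P = D.unif (frameEmbNeg τ ((γ : GL (Fin 3) L) * B) x) := by
  -- the coded frame, its line `W`, and the special cycle's closed set
  set B' : GL (Fin 3) ↥D.E := Matrix.GeneralLinearGroup.map e.toRingHom ((γ : GL (Fin 3) L) * B) with hB'def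
  have hB' : formCongr (conjRingHom D.E) B' D.H = finSum 2 1 ((a⁻¹ • Jstar).map e) ((a⁻¹ • Jperp).map e) :=
    formCongr_glMap_code_mul_eq_finSum τ D e he hH Jperp B ha hB γ
  have hposE : ∀ τ' : ↥D.E →+* ℂ, 0 < (τ' (((a⁻¹ • Jperp).map e) 0 0)).re :=
    D.forall_re_pos_subformRight B' _ _ hB' (D.re_pos_code_subformRight τ e he (a := a) Jperp hτa hτa' hpos)
  have hW : IsTotallyPositive (conjRingHom D.E) D.H (↥D.E ∙ fun i => (B' : Matrix (Fin 3) (Fin 3) ↥D.E) i (Fin.last 2)) :=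
    D.isTotallyPositive_span_lastCol B' _ _ hB' hposE
  obtain ⟨Z, hZc, hZpt, -⟩ :=
    Literature.NumberTheory.Automorphic.PicardCM.specialCyclesAlgebraic_holds D.E D.H D.Γ X D.unif D.conj_H_apply D.anisotropic
      D.signature_τ₁ D.posDef_of_ne D.isCongruenceSubgroup D.torsionFree D.isSmoothProjective D.isBallUniformisation _ hW
  refine ⟨Z, hZc, fun P => (hZpt P).trans ?_⟩
  -- `unif '' subCone(W^⊥) = {unif((γB)^τ(x ⊕ 0)) : x ∈ 𝔻(J⋆^τ)}`
  have hJ : (D.E.subtype (((a⁻¹ • Jperp).map e) 0 0)) ≠ 0 := by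
    intro h0
    have h1 := hposE D.E.subtype
    rw [h0, Complex.zero_re] at h1
    exact lt_irrefl _ h1
  have hHℂ : D.Hℂ = H.map τ := Hℂ_eq_map_of_code τ D e he hH
  have hγB : formCongr ((IsCMField.complexConj L : L ≃ₐ[↥(maximalRealSubfield L)] L) : L →+* L)
      ((γ : GL (Fin 3) L) * B) (a • H) = finSum 2 1 Jstar Jperp := by
    rw [formCongr_mul_of_mem_rational γ B a]; exact hB
  constructor
  · rintro ⟨u, ⟨hucone, huorth⟩, rfl⟩
    -- `u` is orthogonal to the last column, hence `u = embMatrix(B′)·v = (γB)^τ(v ⊕ 0)`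
    have hu0 : D.pairE (fun i => (B' : Matrix (Fin 3) (Fin 3) ↥D.E) i (Fin.last 2)) u = 0 :=
      huorth _ ⟨_, Submodule.mem_span_singleton_self _, rfl⟩
    obtain ⟨v, hv⟩ := D.exists_embMatrix_mulVec_eq_of_pairE_eq_zero B' _ _ hB' hJ hu0
    refine ⟨v, ?_, ?_⟩
    · rw [← negCone_map_code_smul_eq τ D e he (Jstar := Jstar) hτa hτa', ← D.embMatrix_mulVec_mem_cone_iff B' _ _ hB', hv]
      exact hucone
    · rw [← hv, hB'def, embMatrix_glMap_mulVec_eq_frameEmbNeg τ D e he]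
  · rintro ⟨x, hx, rfl⟩
    refine ⟨frameEmbNeg τ ((γ : GL (Fin 3) L) * B) x, ⟨?_, ?_⟩, rfl⟩
    · -- negative
      change _ ∈ negCone D.Hℂ
      rw [hHℂ]
      exact frameEmbNeg_mem_negCone τ hγB hτa hτa' hx
    · -- orthogonal to `τ₁(W)`
      rintro _ ⟨w, hw, rfl⟩
      have h := D.hermForm_map_span_lastCol_embMatrix_mulVec B' _ _ hB' w hw x
      rw [hB'def, embMatrix_glMap_mulVec_eq_frameEmbNeg τ D e he] at h
      exact h

end UnitaryBallUniformisationDatum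

end Literature.AlgebraicGeometry.ShimuraVarieties

end
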